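import Summits.CriticalPhenomena.PercolationContinuityZ3.Theorems.PercNearOneGluingNoHeavyLowerTailSahiCombFiveUpSetRank

/-!
# The five-up-set inequality, RANK route VI: the ANTIPODAL EXTENSION LEMMA (the workhorse of the a = 2 rank proofs)

Support file of the one-cut programme (crux `NoHeavyLowerTail`, stmt-CriticalPhenomena-4575; cell `prim-masterthm` seat P5, gen 11;
report `P5-LORENTZIAN-TEST.md` §16.9–§16.12, memo `FROM-prim-masterthm-p5-g11-TOPDOWN-FILTRATION.md` §11).

In the paper proofs of Lemma A (two class pairs of CERT-Z are jointly independent) and of (Z3) at `a = 2` (the D-part of CERT-Z with the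
harmonic directions is independent, report §16.12) one step is used six times: a combination `Φ = Σ_d φ d · ζ_d` of zeta functions
`ζ_d(t) = [d ⊆ t]` whose indices `d` all have their complement in an up-set `S` is determined, on any up-set `T`, by its values on `S ∩ T`
(facts F2/F3 of the report: `Φ|_T` lies in the antipodal subspace `𝔅_T(S ∩ T)`, on which restriction to `S ∩ T` is injective by C1).

* `antipodal_extension` — if `φ d ≠ 0 → dᶜ ∈ S` and `Σ_d φ d [d ⊆ t] = 0` for all `t ∈ S ∩ T` (`S, T` up-sets), then `Σ_d φ d [d ⊆ t] = 0` for
  all `t ∈ T`.  Proof: expand each `ζ_d|_T` by the support lemma `exists_support_coef` (indices `e ⊆ d` with `eᶜ ∈ T`, hence `eᶜ ∈ S ∩ T`),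
  collect the coefficients `g e`, and apply C1 in coefficient form (`eq_zero_of_zeta_sum_eq_zero`) on the up-set `S ∩ T`.
HONEST LABEL: one lemma with a complete proof (std axioms); it proves nothing about `TriWIneq` by itself. [this work]
-/

namespace Summit.CriticalPhenomena.PercolationContinuityZ3.Theorems

namespace FiveUpSet

open Finset

variable {α : Type} [DecidableEq α] [Fintype α]

/-- **Antipodal extension lemma.**  `S, T` up-sets of the cube `Finset α`; `φ` supported on sets whose complement lies in `S`.
If the zeta combination `t ↦ Σ_d φ d · [d ⊆ t]` vanishes on `S ∩ T`, it vanishes on all of `T`. [this work] -/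
theorem antipodal_extension {S T : Finset (Finset α)} (hS : IsUpperSet (S : Set (Finset α)))
    (hT : IsUpperSet (T : Set (Finset α))) (φ : Finset α → ℚ) (hφ : ∀ d, φ d ≠ 0 → dᶜ ∈ S)
    (h : ∀ t, t ∈ S → t ∈ T → ∑ d, φ d * (if d ⊆ t then (1 : ℚ) else 0) = 0) :
    ∀ t, t ∈ T → ∑ d, φ d * (if d ⊆ t then (1 : ℚ) else 0) = 0 := by
  -- support lemma on the up-set `T`, one coefficient vector per index `d`
  choose c hc1 hc2 hc3 using fun d => exists_support_coef hT d
  -- the collected coefficients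
  set g : Finset α → ℚ := fun e => ∑ d, φ d * c d e with hg
  -- on `T`, the combination equals the `g`-combination
  have hexp : ∀ t, t ∈ T →
      ∑ d, φ d * (if d ⊆ t then (1 : ℚ) else 0) = ∑ e, g e * (if e ⊆ t then (1 : ℚ) else 0) := by
    intro t ht
    have h1 : ∑ d, φ d * (if d ⊆ t then (1 : ℚ) else 0) = ∑ d, φ d * ∑ e, c d e * (if e ⊆ t then (1 : ℚ) else 0) := by
      refine Finset.sum_congr rfl fun d _ => ?_
      rw [hc3 d t ht]
    rw [h1]
    simp only [hg, Finset.mul_sum, Finset.sum_mul]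
    rw [Finset.sum_comm]
    refine Finset.sum_congr rfl fun e _ => Finset.sum_congr rfl fun d _ => ?_
    ring
  -- `g` is supported on `e` with `eᶜ ∈ S ∩ T`
  have hgsupp : ∀ e, g e ≠ 0 → eᶜ ∈ S ∩ T := by
    intro e he
    obtain ⟨d, _, hd⟩ := Finset.exists_ne_zero_of_sum_ne_zero (by rw [hg] at he; exact he)
    have hφd : φ d ≠ 0 := by
      intro h0; apply hd; rw [h0, zero_mul]
    have hcd : c d e ≠ 0 := by
      intro h0; apply hd; rw [h0, mul_zero]
    have h2 := hc2 d e hcd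
    refine mem_inter.2 ⟨?_, h2.1⟩
    -- `e ⊆ d` so `dᶜ ⊆ eᶜ`, and `dᶜ ∈ S` with `S` an up-set
    exact hS (compl_subset_compl.2 h2.2) (hφ d hφd)
  -- C1 on the up-set `S ∩ T`
  have hST : IsUpperSet ((S ∩ T : Finset (Finset α)) : Set (Finset α)) := by
    rw [coe_inter]; exact hS.inter hT
  have hgzero : ∀ e, g e = 0 := by
    refine eq_zero_of_zeta_sum_eq_zero hST g hgsupp ?_
    intro t ht
    rw [← hexp t (mem_inter.1 ht).2]
    exact h t (mem_inter.1 ht).1 (mem_inter.1 ht).2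
  intro t ht
  rw [hexp t ht]
  refine Finset.sum_eq_zero fun e _ => ?_
  rw [hgzero e, zero_mul]

/-- Corollary (the form used in the proofs): two such combinations that agree on `S ∩ T` agree on `T`, when the indices of the
difference have complements in `S`.  Stated for one combination `φ` against the zero function: if `ψ` and `φ` are both supported on
`{d : dᶜ ∈ S}` and their zeta combinations agree on `S ∩ T`, they agree on `T`. [this work] -/
theorem antipodal_extension_sub {S T : Finset (Finset α)} (hS : IsUpperSet (S : Set (Finset α)))
    (hT : IsUpperSet (T : Set (Finset α))) (φ ψ : Finset α → ℚ) (hφ : ∀ d, φ d ≠ 0 → dᶜ ∈ S) (hψ : ∀ d, ψ d ≠ 0 → dᶜ ∈ S)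
    (h : ∀ t, t ∈ S → t ∈ T →
      ∑ d, φ d * (if d ⊆ t then (1 : ℚ) else 0) = ∑ d, ψ d * (if d ⊆ t then (1 : ℚ) else 0)) :
    ∀ t, t ∈ T → ∑ d, φ d * (if d ⊆ t then (1 : ℚ) else 0) = ∑ d, ψ d * (if d ⊆ t then (1 : ℚ) else 0) := by
  have hsupp : ∀ d, (φ d - ψ d) ≠ 0 → dᶜ ∈ S := by
    intro d hd
    by_cases h1 : φ d = 0
    · have h2 : ψ d ≠ 0 := by intro h2; apply hd; rw [h1, h2, sub_zero]
      exact hψ d h2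
    · exact hφ d h1
  have key := antipodal_extension hS hT (fun d => φ d - ψ d) hsupp ?_
  · intro t ht
    have e := key t ht
    have e2 : ∑ d, (φ d - ψ d) * (if d ⊆ t then (1 : ℚ) else 0)
        = ∑ d, φ d * (if d ⊆ t then (1 : ℚ) else 0) - ∑ d, ψ d * (if d ⊆ t then (1 : ℚ) else 0) := by
      rw [← Finset.sum_sub_distrib]
      refine Finset.sum_congr rfl fun d _ => ?_
      ring
    rw [e2] at e
    linarith
  · intro t hs ht
    have e2 : ∑ d, (φ d - ψ d) * (if d ⊆ t then (1 : ℚ) else 0)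
        = ∑ d, φ d * (if d ⊆ t then (1 : ℚ) else 0) - ∑ d, ψ d * (if d ⊆ t then (1 : ℚ) else 0) := by
      rw [← Finset.sum_sub_distrib]
      refine Finset.sum_congr rfl fun d _ => ?_
      ring
    rw [e2, h t hs ht, sub_self]

end FiveUpSet

end Summit.CriticalPhenomena.PercolationContinuityZ3.Theorems
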